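/-
Copyright: statement-level skeleton of a published paper (lit-balaban cell, Phase-2 proof seat p25, gen 19). No proof
claims beyond what the kernel checks below.
-/
import Literature.MathematicalPhysics.QuantumFieldTheory.BalabanImbrieJaffe1984to88.BIJ88WalkIneq312Remainder
import Literature.MathematicalPhysics.QuantumFieldTheory.BalabanImbrieJaffe1984to88.BIJ88WalkLabelPartition312

/-!
# `BalabanImbrieJaffe1984to88.BIJ88WalkIneq312RemainderBdry` — T. Bałaban, J. Imbrie, A. Jaffe, *Effective action and
cluster properties of the abelian Higgs model*, Commun. Math. Phys. **114** (1988) 257–315 [BalabanImbrieJaffe1988],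
§5.14 p. 312 [PDF 56], verbatim (x2 render `lit-balaban-r16/renders/cmp114/original-p056-x2.png`): *"By performing
sufficiently many integrations by parts, we have arranged for enough small factors to beat these large factors in the
remainder terms (at least if X_{r′} is not at the boundary of Λ₁₂^{(k)}). Near the boundary we have potentially large
covariances C^{(k)}_{Λ₁₂^{(k)},loc} − C^{(k)}_{loc} or C^{(k)}_{Λ₁₂^{(k)},loc}(u_{k+1}) − C^{(k)}_{loc}(u_{k+1}), so we make
use of the proximity to Λ₁₂^{(k)c} to provide the necessary convergence. These considerations lead to the following
estimate: |G_k(X)| ≤ c(F(X))(e^β(L^kε/ε₀)^{1/4−α})^{β′|X∖∪_cX_c|} × Π_{X_{σ_1} ⊂ X : dist(X_{σ_1}, Λ₁₂^{(k)c}) < r(e_k)}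
[c(L^kε)^{−m(c)}e^{−m′(c)}]."* — **THE TYPED LEAF `Ineq312` FOR THE LOCATED REMAINDER FAMILIES WITH THE PRINTED
BOUNDARY-RESTRICTED PRODUCT** (p25 gen 19; the owner's flip path, r16 v2.274/v2.281 item (B); HEAD THEOREM OF RECORD of the row
since r16 v2.284, ref-5 g68 countersigned; v1.1 docfix: the head theorem's tag names the unnumbered estimate
preceding (5.14.5), ref-5 g68 xref note; declarations untouched): the sibling
`BIJ88WalkIneq312Remainder.ineq312_remainder` charges the large constant `B_ℓ^{|obs j|}` for EVERY observable `j ∈ O`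
(declared weakening (H3)); here, AS PRINTED, only the observables `j ∈ O ∩ bdry` NEAR THE BOUNDARY are charged —
`obsProd_bdry(O,𝒳) = Π_{j ∈ O, j ∈ bdry} B_ℓ^{|obs j|}` with `bdry : Finset κ` the GEOMETRY DATUM *"X_{σ_1} ⊂ X :
dist(X_{σ_1}, Λ₁₂^{(k)c}) < r(e_k)"* — under the explicit per-remainder-component BEATING CLAUSE `hbeat` named against
*"we have arranged for enough small factors to beat these large factors in the remainder terms (at least if X_{r′} is
not at the boundary of Λ₁₂^{(k)})"*: for every remainder component `X_r` of a no-block term,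
`s·Π_{j ∈ lab X_r, j ∉ bdry} B_ℓ^{|obs j|} ≤ 1` (`s = max(η_χ, θ_v^M, θ_w)` the per-component small factor of
`BIJ88WalkRemainderSmall312` — print's *"sufficiently many integrations by parts"* is the choice of `m̄ = M` making
`θ_v^M` small enough; not made here).  Conclusion (`ineq312_remainder_bdry`):
`Ineq312 remSys (remAt(O,𝒳)/Z) (K_χ·Λ_O·W_O^{Φ₀(O)}) (Π_{j∈O∩bdry} B_ℓ^{|obs j|}) (Σ_r #(X_r∖obs cubes)) θ 1` — the
`s^{#𝒳}` of the sibling's `cF` is spent on the interior large factors (labels partition `O` across the remainder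
components, `BIJ88WalkLabelPartition312.prod_labels_eq`).

statement-level skeleton of published theorems with citation tags; proofs where landed; nothing here is a claim
about the Yang–Mills mass gap

PDF held: `paper:balaban1988-cmp114-bij-abelian-higgs-effective-action` (journal page = PDF page + 256); p. 312 =
PDF 56 (`p0056.txt` L20–31; x2 render re-read this session, 2026-08-23).

CITATION HEADER (lean-in-tree rule).  lit-balaban cell (HOME `run/shared/lean/pub/lit-balaban/`), Phase 2, seat p25
gen 19; row **C2.Claim@312** of `HOME/lit-balaban-r16/ROWS-C2-part2.md` (owner r16, referee ref-5).  The typed leaf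
`BIJ88Sect5StatementsPart4.Ineq312` (r16) is USED BY NAME and INHABITED; the head's status word is the owner's call.
USED BY NAME, nothing restated: `BIJ88WalkIneq312Remainder.{remSys, phi0}`, `BIJ88WalkRemainderActivity312.{remAt, rloc,
nfreeOf, card_rloc, abs_remAt_div_le}`, `BIJ88WalkLabelPartition312.prod_labels_eq` (p25 gen 18–19), the §5.13 model of
record (`prec`, `src`, `corner`, `fieldLaw`).

## What is proved (0 `sorry`, standard axioms, no new `Prop` facts; theorems only)

* `prod_obs_mul_small_le_bdry` (the interior large factors of one no-block term are beaten:
  `s^{#groups}·Π_{j∈O} B_ℓ^{|obs j|} ≤ Π_{j∈O∩bdry} B_ℓ^{|obs j|}` under `hbeat`), **`ineq312_remainder_bdry`**.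

HONEST SCOPE — THE HEAD-QUESTION CLAUSES (owner r16 (H1)–(H5), as in the sibling's header, with (H3) replaced):
(H1) object = located remainder family activity AS PRODUCED by `expand` (`BIJ88WalkRemainderCovers312.rloc_covers_init`:
each member covers the cubes of one of its observables); (H2) both small-factor kinds visible (`θ^{nfree}` in the
conclusion; the per-component `s` now SPENT in `hbeat`), every abstract binder a named clause matched to its printed
input (dictionary in the sibling's header: `B_ℓ` ↔ `|F_{k,loc}(X_{σ_1})| ≤ c(L^kε)^{−m(c)}e^{−m′(c)}`; `θ`, `θ_v` ↔
`e^β(L^kε/ε₀)^{1/4−α}`; `θ_w·θ^{#reg}` ↔ *"The others, localized in region X, have a factor of e^{−cr(e_k)|X|}"* p. 310;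
`η_χ` ↔ *"Each t-derivative of a χ-factor in χ_{Λ₁₂^{(k)},t} gives at least a factor …"* p. 309, made concrete as
`η_χ = 1/p` in `BIJ88WalkScaledCutoff309`; `ρ₀`, `N₀` ↔ the `O(r(e_k))` cut-off of `C_{Λ,loc}` p. 310 and the local
`V^{(k)}(Y)`; `K_χ·Λ_O` ↔ the moments / cutoff derivatives print leaves to *"Without going into details"*, reduced in
`BIJ88WalkRemainderExpectation312`), NONE discharged on the model of record; **(H3) AS PRINTED: the boundary-restricted
product `Π_{j∈O∩bdry}`; the interior large factors are beaten by the clause `hbeat`** — `bdry` is abstract geometry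
data (print: the observables whose support is within `r(e_k)` of `Λ₁₂^{(k)c}`) and `hbeat` is a HYPOTHESIS (print's
choice of `m̄`, of the couplings and of `r(e_k)`; not derived); (H4) the boundary mechanism (*"proximity to Λ₁₂^{(k)c}"*)
is not modelled — the pieces `Cov p` are abstract; (H5) `remAt(O,𝒳)/Z` is the located remainder activity BEFORE
print's final cluster expansion (*"Mayer-expanding V^{(k)}(Y)'s and interpolating the Gaussian measure. Finally the
polymer expansion u = 1 + a permits us to factor out the normalization."*), the unions `X_{r′} ⊇ X_r` not formed.
Further: contraction-graph components; the leaf constrains only the SHAPE `|Gk| ≤ cF·θ^{β′·nfree}·obsProd`.  NOT summit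
progress; NOT continuum; NOT Clay.  Imports `BIJ88WalkIneq312Remainder`, `BIJ88WalkLabelPartition312`; modifies nothing.
-/

noncomputable section

namespace Literature.MathematicalPhysics.QuantumFieldTheory.BalabanImbrieJaffe1984to88.BIJ88WalkIneq312RemainderBdry

open Classical MeasureTheory Matrix Finset
open scoped BigOperators
open Literature.MathematicalPhysics.QuantumFieldTheory.Balaban1983to89
open B2Eq228Conditioning (weight source)
open BIJ88PolymerRep5134 (corner)
open BIJ88PolymerRep5134Gauss (prec src)
open BIJ88SlotMomentsGauss308 (fieldLaw)
open BIJ88VertexIbp311 (vexp)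
open BIJ88WickDerivatives305 (dlist)
open BIJ88VertexComponents311 (maxArity)
open BIJ88WalkRun311 BIJ88WalkExpansion311 BIJ88WalkLabelPartition312 BIJ88WalkRemainderActivity312
  BIJ88WalkIneq312Remainder

variable {S : Type} [Fintype S] {ι : Type} [Fintype ι] {κ : Type} [LinearOrder κ] {P : Type} [Fintype P]
  {β : Type} [DecidableEq β]

/-! ## §1  The interior large factors of a no-block term are beaten -/

/-- **THE INTERIOR LARGE FACTORS ARE BEATEN, ONE REMAINDER COMPONENT AT A TIME**: for a no-block term `t` of
`expand 0 O` (labels partition `O` across its remainder components) and `s ≥ 0` with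
`s·Π_{j∈lab X_r, j∉bdry} B_ℓ^{|obs j|} ≤ 1` for every `X_r ∈ t.groups`:
`s^{#groups}·Π_{j∈O} B_ℓ^{|obs j|} ≤ Π_{j∈O, j∈bdry} B_ℓ^{|obs j|}`. [cite: BalabanImbrieJaffe1988, §5.14 p.312] -/
theorem prod_obs_mul_small_le_bdry {Cov : P → Matrix S S ℝ} {trig : P → Bool} {f : S → ℝ} {c : ι → ℝ}
    {legs : ι → List (S → ℝ)} {obs : κ → List (S → ℝ)} {M : ℕ} {Bl s : ℝ} (hBl : 1 ≤ Bl) (hs : 0 ≤ s)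
    (bdry : Finset κ) {O : Finset κ} {t : WTerm S κ ι P} (ht : t ∈ expand Cov trig f c legs obs M 0 O)
    (hc : t.consts = 0)
    (hbeat : ∀ X ∈ t.groups, s * ∏ j ∈ X.lab.filter (fun j => j ∉ bdry), Bl ^ (obs j).length ≤ 1) :
    s ^ Multiset.card t.groups * ∏ j ∈ O, Bl ^ (obs j).length
      ≤ ∏ j ∈ O.filter (fun j => j ∈ bdry), Bl ^ (obs j).length := by
  have hBl0 : 0 ≤ Bl := zero_le_one.trans hBl
  -- labels partition `O` across the remainder components (no block)
  have h1 := prod_labels_eq (Cov := Cov) (trig := trig) (f := f) (c := c) (legs := legs) (obs := obs) (M := M)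
    (fun j => Bl ^ (obs j).length) O t ht
  have h2 := prod_labels_eq (Cov := Cov) (trig := trig) (f := f) (c := c) (legs := legs) (obs := obs) (M := M)
    (fun j => if j ∈ bdry then Bl ^ (obs j).length else 1) O t ht
  rw [hc, zero_add] at h1 h2
  rw [Finset.prod_filter, ← h1, ← h2]
  -- `s^{#groups}·Π_X(Π_{lab X} B_ℓ) = Π_X (s·Π_{lab X} B_ℓ)`
  have e : s ^ Multiset.card t.groups * (t.groups.map fun X => ∏ j ∈ X.lab, Bl ^ (obs j).length).prod
      = (t.groups.map fun X => s * ∏ j ∈ X.lab, Bl ^ (obs j).length).prod := by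
    rw [Multiset.prod_map_mul, Multiset.map_const', Multiset.prod_replicate]
  rw [e]
  refine Multiset.prod_map_le_prod_map₀ _ _ (fun X _ => mul_nonneg hs (prod_nonneg fun j _ => pow_nonneg hBl0 _))
    fun X hX => ?_
  -- one component: split its observables into boundary and interior ones
  rw [← Finset.prod_filter_mul_prod_filter_not X.lab (fun j => j ∈ bdry), ← Finset.prod_filter]
  have hA : 0 ≤ ∏ j ∈ X.lab.filter (fun j => j ∈ bdry), Bl ^ (obs j).length :=
    prod_nonneg fun j _ => pow_nonneg hBl0 _
  calc s * ((∏ j ∈ X.lab.filter (fun j => j ∈ bdry), Bl ^ (obs j).length)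
        * ∏ j ∈ X.lab.filter (fun j => j ∉ bdry), Bl ^ (obs j).length)
      = (∏ j ∈ X.lab.filter (fun j => j ∈ bdry), Bl ^ (obs j).length)
        * (s * ∏ j ∈ X.lab.filter (fun j => j ∉ bdry), Bl ^ (obs j).length) := by ring
    _ ≤ (∏ j ∈ X.lab.filter (fun j => j ∈ bdry), Bl ^ (obs j).length) * 1 :=
        mul_le_mul_of_nonneg_left (hbeat X hX) hA
    _ = _ := mul_one _

/-! ## §2  The leaf with the printed boundary-restricted product -/

variable {α I : Type} [Fintype α] [DecidableEq α] [Fintype I] [DecidableEq I]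
  {blk : α → I} {Δ : Matrix α α ℝ} {ℱ : α → ℝ} {W : Finset I}

/-- **THE TYPED LEAF `Ineq312` FOR THE LOCATED REMAINDER FAMILIES, BOUNDARY-RESTRICTED AS PRINTED**: under the
hypotheses of `BIJ88WalkIneq312Remainder.ineq312_remainder` and the beating clause `hbeat` (for every `O`, every
no-block term of `expand 0 O` and every remainder component `X_r` of it: `s·Π_{j∈lab X_r, j∉bdry} B_ℓ^{|obs j|} ≤ 1`,
`s = max(η_χ, θ_v^M, θ_w)`), with `bdry` the observables near the boundary:
`Ineq312 remSys (remAt(O,𝒳)/Z) (K_χ·Λ_O·W_O^{Φ₀(O)}) (Π_{j∈O, j∈bdry} B_ℓ^{|obs j|}) (Σ_r #(X_r ∖ obs cubes)) θ 1`,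
`W_O = max(1, ρ₀·(Φ₀(O)+N₀))` — print's `|G_k(X)| ≤ c(F(X))(e^β(L^kε/ε₀)^{1/4−α})^{β′|X∖∪_cX_c|} ×
Π_{X_{σ_1} ⊂ X : dist(X_{σ_1}, Λ₁₂^{(k)c}) < r(e_k)} [c(L^kε)^{−m(c)}e^{−m′(c)}]` for the located remainder families,
pre-cluster-expansion. [cite: BalabanImbrieJaffe1988, §5.14 p.312 (estimate preceding (5.14.5))] -/
theorem ineq312_remainder_bdry (hPD : (prec blk Δ W (corner ℝ W)).PosDef)
    {Cov : P → Matrix {x : α // blk x ∈ W} {x : α // blk x ∈ W} ℝ} {trig : P → Bool} {c : ι → ℝ}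
    {legs : ι → List ({x : α // blk x ∈ W} → ℝ)} {obs : κ → List ({x : α // blk x ∈ W} → ℝ)} {M : ℕ}
    {χ : ({x : α // blk x ∈ W} → ℝ) → ℝ} {oc : κ → Finset β} {vc : ι → Finset β} {reg : P → Finset β}
    {Dir : Set ({x : α // blk x ∈ W} → ℝ)} {B' ρ : P → ℝ} {cV : ι → ℝ} {Bl θ θv θw ηχ ρ₀ Kχ : ℝ} {Λ : Finset κ → ℝ}
    {N₀ : ℕ}
    (hθ0 : 0 < θ) (hθ1 : θ ≤ 1) (hBl : 1 ≤ Bl) (hB0 : ∀ p, 0 ≤ B' p) (hρ : ∀ p, 0 ≤ ρ p) (hcV0 : ∀ m, 0 ≤ cV m)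
    (hη0 : 0 ≤ ηχ) (hη1 : ηχ ≤ 1) (hθv : 0 < θv) (hθv1 : θv ≤ 1) (hθw : 0 < θw) (hθw1 : θw ≤ 1)
    (hB : ∀ p, ∀ u ∈ Dir, ∀ w ∈ Dir, |(Cov p *ᵥ u) ⬝ᵥ w| ≤ B' p * ρ p)
    (hBf : ∀ p, ∀ u ∈ Dir, |(Cov p *ᵥ u) ⬝ᵥ src blk ℱ W| ≤ B' p * ρ p)
    (hBz : ∀ p, ∀ u ∈ Dir, ‖Cov p *ᵥ u‖ ≤ B' p * ρ p)
    (hcV : ∀ m, |c m| ≤ cV m) (hobs : ∀ j, ∀ w ∈ obs j, w ∈ Dir) (hlegs : ∀ m, ∀ w ∈ legs m, w ∈ Dir)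
    (hloc : ∀ p, trig p = false → B' p ≤ Bl ∧ reg p = ∅) (hwalk : ∀ p, trig p = true → B' p ≤ θw * θ ^ (reg p).card)
    (hvert : ∀ m, cV m * Bl ^ (legs m).length ≤ θv * θ ^ (vc m).card) (hρ₀0 : 0 ≤ ρ₀)
    (hρ₀ : ∀ u ∈ Dir, (∑ p ∈ univ.filter (fun p => Cov p *ᵥ u ≠ 0), ρ p) ≤ ρ₀)
    (hN : ∀ p, ∀ u ∈ Dir,
      (∑ m, ((range (legs m).length).filter fun j => (Cov p *ᵥ u) ⬝ᵥ (legs m).getD j 0 ≠ 0).card) ≤ N₀)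
    (hKχ : 0 ≤ Kχ) (hΛ : ∀ O, 0 ≤ Λ O)
    (hE : ∀ O : Finset κ, ∀ t ∈ expand Cov trig (src blk ℱ W) c legs obs M 0 O, t.consts = 0 →
      |∫ φ, ((t.groups.map fun h => (h.pend : Multiset _)).sum.map fun w => φ ⬝ᵥ w).prod
          * (dlist t.dirs χ φ * vexp c legs φ) ∂(fieldLaw blk Δ ℱ W)|
        ≤ Kχ * (t.dirs.map fun z => ηχ * ‖z‖).prod * Λ O)
    (bdry : Finset κ)
    (hbeat : ∀ O : Finset κ, ∀ t ∈ expand Cov trig (src blk ℱ W) c legs obs M 0 O, t.consts = 0 → ∀ X ∈ t.groups,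
      max ηχ (max (θv ^ M) θw) * ∏ j ∈ X.lab.filter (fun j => j ∉ bdry), Bl ^ (obs j).length ≤ 1) :
    BIJ88Sect5StatementsPart4.Ineq312 (remSys κ β)
      (fun OX => remAt (prec blk Δ W (corner ℝ W)) Cov trig (src blk ℱ W) c legs obs M χ oc vc reg [] 0 OX.1 OX.2
        / ∫ φ, weight (prec blk Δ W (corner ℝ W)) φ * source (src blk ℱ W) φ)
      (fun OX => Kχ * Λ OX.1 * (max 1 (ρ₀ * ((phi0 legs obs M OX.1 + N₀ : ℕ) : ℝ))) ^ phi0 legs obs M OX.1)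
      (fun OX => ∏ j ∈ OX.1.filter (fun j => j ∈ bdry), Bl ^ (obs j).length)
      (fun OX => nfreeOf oc OX.2) θ 1 := by
  intro OX
  obtain ⟨O, 𝒳⟩ := OX
  have hnf : θ ^ ((1 : ℝ) * (nfreeOf oc 𝒳 : ℕ)) = θ ^ nfreeOf oc 𝒳 := by rw [one_mul, Real.rpow_natCast]
  simp only []
  rw [hnf]
  have hBl0 : 0 ≤ Bl := zero_le_one.trans hBl
  set Wc := max 1 (ρ₀ * ((phi0 legs obs M O + N₀ : ℕ) : ℝ)) with hWc
  set s := max ηχ (max (θv ^ M) θw) with hs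
  have hs0 : 0 ≤ s := hη0.trans (le_max_left _ _)
  have hW1 : 1 ≤ Wc := le_max_left _ _
  have hC0 : 0 ≤ Kχ * Λ O * Wc ^ phi0 legs obs M O * θ ^ nfreeOf oc 𝒳 :=
    mul_nonneg (mul_nonneg (mul_nonneg hKχ (hΛ O)) (pow_nonneg (zero_le_one.trans hW1) _)) (pow_nonneg hθ0.le _)
  have hP0 : 0 ≤ ∏ j ∈ O.filter (fun j => j ∈ bdry), Bl ^ (obs j).length := prod_nonneg fun j _ => pow_nonneg hBl0 _
  by_cases hex : ∃ t ∈ expand Cov trig (src blk ℱ W) c legs obs M 0 O, t.consts = 0 ∧ rloc oc vc reg t = 𝒳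
  · obtain ⟨t, ht, hc, h𝒳⟩ := hex
    have hW : ρ₀ * ((∑ j ∈ O, ((obs j).length + 1 + M * maxArity legs) + N₀ : ℕ) : ℝ) ≤ Wc := le_max_right _ _
    have h := abs_remAt_div_le (oc := oc) (vc := vc) (reg := reg) (χ := χ) hPD hθ0 hθ1 hBl hB0 hρ hcV0 hη0 hη1 hθv
      hθv1 hθw hθw1 hB hBf hBz hcV hobs hlegs hloc hwalk hvert hρ₀0 hρ₀ hN O hW1 hW hKχ (hΛ O) (hE O) 𝒳
    have hcard : Multiset.card 𝒳 = Multiset.card t.groups := by rw [← h𝒳, card_rloc]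
    have hbeat' := prod_obs_mul_small_le_bdry hBl hs0 bdry ht hc (hbeat O t ht hc)
    rw [← hcard] at hbeat'
    calc _ ≤ Kχ * Λ O * (Wc ^ (∑ j ∈ O, ((obs j).length + 1 + M * maxArity legs)) * ∏ j ∈ O, Bl ^ (obs j).length)
          * (θ ^ nfreeOf oc 𝒳 * s ^ Multiset.card 𝒳) := h
      _ = Kχ * Λ O * Wc ^ phi0 legs obs M O * θ ^ nfreeOf oc 𝒳
          * (s ^ Multiset.card 𝒳 * ∏ j ∈ O, Bl ^ (obs j).length) := by rw [phi0]; ring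
      _ ≤ Kχ * Λ O * Wc ^ phi0 legs obs M O * θ ^ nfreeOf oc 𝒳
          * ∏ j ∈ O.filter (fun j => j ∈ bdry), Bl ^ (obs j).length := mul_le_mul_of_nonneg_left hbeat' hC0
      _ = _ := by ring
  · -- no no-block term is located at `𝒳`: the localized remainder part vanishes
    have h0 : remAt (prec blk Δ W (corner ℝ W)) Cov trig (src blk ℱ W) c legs obs M χ oc vc reg [] 0 O 𝒳 = 0 := by
      rw [remAt]
      refine Multiset.sum_eq_zero fun x hx => ?_
      obtain ⟨t, ht, rfl⟩ := Multiset.mem_map.1 hx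
      exact if_neg fun h => hex ⟨t, ht, h⟩
    rw [h0, zero_div, abs_zero]
    exact mul_nonneg hC0 hP0

end Literature.MathematicalPhysics.QuantumFieldTheory.BalabanImbrieJaffe1984to88.BIJ88WalkIneq312RemainderBdry

end
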